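import Summits.SmoothPoincare4.SmoothPoincare4.Theses.VerlindeRLinks
import Literature.Barriers.SmoothPoincare4.PropertyTwoRAndrewsCurtisLink
import HarnessLib.Audit

/-!
# Negative lemma for crux `VerlindeRLinks.VrlSlideGap` (stmt-SmoothPoincare4-16178): the birth line's
heart stub refutes the sibling crux `VrlSliceRigidity`

Refuter crux-attack (2026-08-17). The only registered skeleton for the crux `VrlSlideGap`
(`Cruxes/VrlSlideGap/Lines/birth.lean`) concludes the crux from two stubs: GST's link fact
`stub_gstLink` (Gompf–Scharlemann–Thompson 2010 §7: the 2-component R-links `L_{n,1} = Q ⊔ Vₙ`,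
"strictly slides to a `0`-framed unlink ⇒ `⟨x, y ∣ yxy = xyx, xⁿ⁺¹ = yⁿ⟩` Andrews–Curtis trivial")
and the heart `stub_acNontrivial = Literature.Barriers.SmoothPoincare4.AKPresentationsACNontrivial`
(some such presentation, `n ≥ 3`, is Andrews–Curtis nontrivial).

OBSERVATION (this file): the components of GST's `L_{n,1}` are the square knot
`Q = T_{2,3} # T̄_{2,3}` and `Vₙ = T_{n,n+1} # T̄_{n,n+1}` (GST §1, p. 2), both of the form `K # (-K̄)`
(torus knots are invertible), hence ribbon, hence SMOOTHLY SLICE in `B⁴` (Fox–Milnor 1966; tree: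
`Literature.Topology.FourManifolds.Knot.isSmoothlySlice_of_isConnectedSum_mirror_reverse`, named
fact of `BandSum.lean`). So GST's §7 link fact holds in the sharper printed form "with smoothly slice
components" (hypothesis `hGST` below, stated inline; it implies the tree's
`Literature.Barriers.SmoothPoincare4.gst2010_link_acTrivial_of_slides` by forgetting sliceness).
Feeding that link to the sibling crux
`VrlSliceRigidity` ("every R-link all of whose components are smoothly slice strictly slides to a
`0`-framed unlink") makes every `gstPresentation n` Andrews–Curtis trivial — the NEGATION of the
birth line's heart stub. Hence:

* `not_akPresentationsACNontrivial_of_sliceRigidity` : `hGST → VrlSliceRigidity → ¬ AKPresentationsACNontrivial`;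
* `VrlSliceRigidity_false_of_acNontrivial` : `hGST → AKPresentationsACNontrivial → ¬ VrlSliceRigidity`.

CONSEQUENCE FOR THE ROUTE. `closes` needs `VrlSlideGap ∧ VrlSliceRigidity ∧ VrlComponentsHBallSlice`.
Completing `Lines/birth.lean` (i.e. proving `stub_acNontrivial`, the Andrews–Curtis problem on its
standard family) would close `VrlSlideGap` AND refute `VrlSliceRigidity` (modulo the in-print `hGST`),
breaking the route instead of closing it. The two typed cruxes are jointly satisfiable only if EVERY
R-link that resists sliding has a non-slice component; in particular every `L_{n,1}` must slide,
i.e. every `AK(n)` must be Andrews–Curtis trivial. The planner's header records the bet ("the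
Andrews–Curtis obstruction never materialises for links with slice components"); this file records,
kernel-checked, that the registered line for `VrlSlideGap` is exactly that obstruction. No new
definition and no named fact is introduced (the sharpened GST fact is an explicit hypothesis).

References: [GompfScharlemannThompson2010, §1 p. 2 (L_{n,1} = Q ⊔ Vₙ), §7 (arXiv p. 17), Conj. 3];
[FoxMilnor1966]; [Gompf1991Killing].
-/

noncomputable section

-- every `Summit.SmoothPoincare4.SmoothPoincare4.…` name repeats the summit = sub-problem segment
-- (D-0017 layout); the duplicate is deliberate.
set_option linter.dupNamespace false

namespace Summit.SmoothPoincare4.SmoothPoincare4.Theorems.VrlSlideGap.Negative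

open scoped Manifold ContDiff
open Literature.Topology.FourManifolds
open Literature.Barriers.SmoothPoincare4 (gstPresentation AKPresentationsACNontrivial)
open Summit.SmoothPoincare4.SmoothPoincare4.Theses.VerlindeRLinks (VrlSliceRigidity)

variable [Knot.TubularNbhd.SmoothnessFacts]

/-- **Slice rigidity kills the heart of the birth line.** If GST's links `L_{n,1}` exist with
smoothly slice components (GST §1: `Q` and `Vₙ` are of the form `K # (-K̄)`, ribbon by Fox–Milnor)
and the §7 Andrews–Curtis reading of their strict slides (hypothesis `hGST`), then the sibling
crux `VrlSliceRigidity` forces EVERY `⟨x, y ∣ yxy = xyx, xⁿ⁺¹ = yⁿ⟩` to be Andrews–Curtis trivial,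
i.e. `¬ AKPresentationsACNontrivial` — the negation of `stub_acNontrivial` of `Lines/birth.lean`.
[cite: GompfScharlemannThompson2010, §1 p. 2 and §7] -/
theorem not_akPresentationsACNontrivial_of_sliceRigidity
    (hGST : ∀ n : ℕ, ∃ L : FramedLink (Fin 2),
      (∃ (Y : Type) (_ : TopologicalSpace Y) (_ : T2Space Y) (_ : SecondCountableTopology Y)
          (_ : ChartedSpace (EuclideanSpace ℝ (Fin 3)) Y) (_ : IsManifold (𝓡 3) ∞ Y)
          (_ : CompactSpace Y) (_ : ConnectedSpace Y),
          IsSphereTwoProdCircleSum 2 Y ∧ L.IsSurgery (𝓡 3) Y) ∧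
      (∀ i : Fin 2, (L.component i).IsSmoothlySlice) ∧
      ∀ U : FramedLink (Fin 2), U.IsZeroFramedUnlink →
        IsStrictHandleSlideEquivalent ⟨2, L⟩ ⟨2, U⟩ →
          IsAndrewsCurtisEquivalent (gstPresentation n) (BalancedPresentation.trivial 2))
    (hSR : VrlSliceRigidity) : ¬ AKPresentationsACNontrivial := by
  rintro ⟨n, -, hn⟩
  obtain ⟨L, ⟨Y, _, _, _, _, _, _, _, hY, hL⟩, hslice, hAC⟩ := hGST n
  obtain ⟨U, hU, hLU⟩ := @hSR ‹_› 2 L Y _ _ _ _ _ _ _ hY hL hslice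
  exact hn (hAC U hU hLU)

/-- **The birth line's heart stub refutes the sibling crux** (contrapositive of
`not_akPresentationsACNontrivial_of_sliceRigidity`): GIVEN GST's slice-component link fact `hGST`,
Andrews–Curtis nontriviality of some `AK(n)`, `n ≥ 3` — the registered stub `stub_acNontrivial`
from which `Lines/birth.lean` proves `VrlSlideGap` — implies `¬ VrlSliceRigidity`. So along the
birth line the hypotheses `h₁ : VrlSlideGap`, `h₂ : VrlSliceRigidity` of the route's `closes`
cannot both be established. [cite: GompfScharlemannThompson2010, §7 and Conjecture 3] -/
theorem VrlSliceRigidity_false_of_acNontrivial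
    (hGST : ∀ n : ℕ, ∃ L : FramedLink (Fin 2),
      (∃ (Y : Type) (_ : TopologicalSpace Y) (_ : T2Space Y) (_ : SecondCountableTopology Y)
          (_ : ChartedSpace (EuclideanSpace ℝ (Fin 3)) Y) (_ : IsManifold (𝓡 3) ∞ Y)
          (_ : CompactSpace Y) (_ : ConnectedSpace Y),
          IsSphereTwoProdCircleSum 2 Y ∧ L.IsSurgery (𝓡 3) Y) ∧
      (∀ i : Fin 2, (L.component i).IsSmoothlySlice) ∧
      ∀ U : FramedLink (Fin 2), U.IsZeroFramedUnlink →
        IsStrictHandleSlideEquivalent ⟨2, L⟩ ⟨2, U⟩ →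
          IsAndrewsCurtisEquivalent (gstPresentation n) (BalancedPresentation.trivial 2))
    (hAC : AKPresentationsACNontrivial) : ¬ VrlSliceRigidity :=
  fun hSR ↦ not_akPresentationsACNontrivial_of_sliceRigidity hGST hSR hAC

end Summit.SmoothPoincare4.SmoothPoincare4.Theorems.VrlSlideGap.Negative

end
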